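import Literature.Geometry.Symplectic.SteinDomainSublevel
import HarnessLib

/-!
# Shrinking a Stein domain along a prescribed flow-out of the boundary

Topic `Literature/Geometry/Symplectic`; proofs file of the fact seat of
`Literature.Geometry.Symplectic.Gompf1998_thm13_twoHandles` (**E2**, `SteinTwoHandles.lean`).
`SteinDomainShrinking.lean` / `SteinDomainSublevel.lean` shrink a Stein domain `W` to a high
sublevel set `W_c = {φ ≤ c}` (a Stein domain diffeomorphic to `W`), the diffeomorphism being the
one of Milnor's regular interval theorem, about whose restriction to `∂W` nothing is recorded.
The next step of E2's proof (moving Legendrian attaching circles from `∂W` to `∂W_c`) needs a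
shrinking diffeomorphism **whose boundary map is the flow-out map of a prescribed vector field**
(a field whose flow preserves the complex tangencies of the levels of `φ`).  This file provides
the differential-topological half of that: for *any* flow-out input `D` of the tree
(`Literature.Topology.FourManifolds.FlowoutInput`: a boundary-defining function, here `max φ - φ`,
and a smooth field `ξ` with `ξ(max φ - φ) = 1` near `∂W`) and any cover `Γ` of it by flow boxes
(`FlowoutInput.Cover`, which exist on compact `W`), the **push** of `W` into itself along the
flow-out (`FlowoutInput.Cover.push`, `RegularIntervalBoundary.lean` §5) *is* a diffeomorphism of
`W` onto the sublevel set `{φ ≤ max φ - κ}` (`κ = Γ.pushDepth > 0`, as small as desired by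
shrinking the cover), with its Stein sublevel structure of `SteinDomainSublevel.lean`, and on
`∂W` it is the flow-out map `z ↦ Fl z κ` at depth `κ`.  Everything is **proved**; no named fact.

* `SteinStructure.push_mem_sublevel` — the push lands in `{φ ≤ max φ - κ}`;
* `FlowoutInput.Cover.push_eq_Fl_of_mem_boundary` — on `∂W` the push is `Fl · κ`;
* `SteinStructure.exists_diffeomorph_sublevel_eq_push` — **the push as a diffeomorphism
  `W ≃ₘ {φ ≤ max φ - κ}`** (smooth into the regular domain by
  `HalfSliceAtlas.contMDiff_codRestrict`, inverse `pull` smooth on the image,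
  `FlowoutInput.Cover.contMDiffOn_pull`), equal to `push` pointwise and to `Fl · κ` on `∂W`;
* `SteinStructure.exists_cover_pushDepth_le` — covers of depth `κ ≤ ε` for every `ε > 0`.

## References

* J. Milnor, *Lectures on the h-cobordism theorem* (1965), proof of Thm. 3.4 (the flow-out
  `h(y₀, s) = ψ_{y₀}(s)`); *Morse theory* (1963), Thm. 3.1. [MilnorHCobordism1965] [Milnor1963]
* K. Cieliebak, Ya. Eliashberg, *From Stein to Weinstein and Back* (2012), Def. 1.1 ff.
  [CieliebakEliashberg2012]
-/

noncomputable section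

open scoped Manifold ContDiff Topology
open Set Function Filter

namespace Literature.Geometry.Symplectic

open Literature.Topology.FourManifolds

namespace SteinStructure

variable {W : Type*} [TopologicalSpace W] [T2Space W] [ChartedSpace (EuclideanHalfSpace 4) W]
  [IsManifold (𝓡∂ 4) ∞ W] [CompactSpace W] (S : SteinStructure W)
  {D : FlowoutInput 3 W} (hD : ∀ z, D.f z = sSup (range S.φ) - S.φ z) (Γ : D.Cover)

omit [T2Space W] [CompactSpace W] in
/-- **On the boundary the push is the flow-out map at depth `κ`**: `push z = Fl z κ` for
`z ∈ ∂W` (there the boundary-defining function vanishes and the push time is `τ(0) = κ`).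
[folklore] -/
theorem _root_.Literature.Topology.FourManifolds.FlowoutInput.Cover.push_eq_Fl_of_mem_boundary
    {z : W} (hz : z ∈ (𝓡∂ 4).boundary W) : Γ.push z = Γ.Fl z Γ.pushDepth := by
  have hf0 : D.f z = 0 := (D.f_eq_zero_iff z).2 hz
  rw [Γ.push_of_le (by rw [hf0]; exact Γ.a_pos.le), hf0, Γ.pushTime_eq, zero_div,
    Real.smoothTransition.zero, sub_zero, mul_one]

include hD

/-- For a flow-out input with boundary-defining function `max φ - φ`, the push along the flow-out
lands in the sublevel set `{φ ≤ max φ - κ}`, `κ` the depth of the push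
(`FlowoutInput.Cover.range_push`). [folklore] -/
theorem push_mem_sublevel (z : W) : Γ.push z ∈ S.φ ⁻¹' Iic (sSup (range S.φ) - Γ.pushDepth) := by
  have h : Γ.push z ∈ range Γ.push := mem_range_self z
  rw [Γ.range_push] at h
  have h' : Γ.pushDepth ≤ D.f (Γ.push z) := h
  rw [hD] at h'
  show S.φ (Γ.push z) ≤ sSup (range S.φ) - Γ.pushDepth
  linarith

/-- The depth of a push is below `max φ` as soon as some point of `W` is pushed (the image of the
push is nonempty and lies in `{κ ≤ max φ - φ}`, where `φ ≤ max φ`… precisely: `κ ≤ max φ - φ z`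
for the image point). [folklore] -/
theorem pushDepth_le_of_mem (z : W) : Γ.pushDepth ≤ sSup (range S.φ) - S.φ (Γ.push z) := by
  have h := S.push_mem_sublevel hD Γ z
  simp only [mem_preimage, mem_Iic] at h
  linarith

/-- **The push as a diffeomorphism onto a Stein sublevel set.**  Let `D` be a flow-out input on
the compact Stein `W` with boundary-defining function `max φ - φ`, `Γ` a cover of it, and
`c = max φ - κ` (`κ = Γ.pushDepth`); assume `c < max φ` is above the critical values of `φ`
(`dφ ≠ 0` on `{c ≤ φ}`).  Then there is a diffeomorphism `e : W ≃ₘ {φ ≤ c}` onto the sublevel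
set with its structure `S.subAtlas` (`SteinDomainSublevel.lean`) which *is* the push:
`(e z : W) = Γ.push z` for all `z`, in particular `(e z : W) = Γ.Fl z κ` on `∂W`.  The map is
smooth into the regular domain (`HalfSliceAtlas.contMDiff_codRestrict`), its inverse is
`pull` restricted to the image (`FlowoutInput.Cover.contMDiffOn_pull`, `pull_push`, `push_pull`).
[cite: MilnorHCobordism1965, proof of Thm. 3.4] [cite: Milnor1963, Thm. 3.1] -/
theorem exists_diffeomorph_sublevel_eq_push
    (hc : sSup (range S.φ) - Γ.pushDepth < sSup (range S.φ))
    (hreg : ∀ x, sSup (range S.φ) - Γ.pushDepth ≤ S.φ x → mfderiv (𝓡∂ 4) 𝓘(ℝ, ℝ) S.φ x ≠ 0) :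
    letI := (S.subAtlas hc hreg).chartedSpace
    ∃ e : W ≃ₘ⟮𝓡∂ 4, 𝓡∂ 4⟯ ↥(S.φ ⁻¹' Iic (sSup (range S.φ) - Γ.pushDepth)),
      (∀ z, (e z : W) = Γ.push z) ∧
        ∀ z ∈ (𝓡∂ 4).boundary W, (e z : W) = Γ.Fl z Γ.pushDepth := by
  set A := S.subAtlas hc hreg with hA
  letI := A.chartedSpace
  haveI := A.isManifold
  have hmem : ∀ z, Γ.push z ∈ S.φ ⁻¹' Iic (sSup (range S.φ) - Γ.pushDepth) :=
    S.push_mem_sublevel hD Γ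
  have hmem' : ∀ w : ↥(S.φ ⁻¹' Iic (sSup (range S.φ) - Γ.pushDepth)),
      (w : W) ∈ {w | Γ.pushDepth ≤ D.f w} := by
    intro w
    have hw : S.φ w.1 ≤ sSup (range S.φ) - Γ.pushDepth := w.2
    show Γ.pushDepth ≤ D.f w.1
    rw [hD]
    linarith
  have hto : ContMDiff (𝓡∂ 4) (𝓡∂ 4) ∞
      ((S.φ ⁻¹' Iic (sSup (range S.φ) - Γ.pushDepth)).codRestrict Γ.push hmem) :=
    A.contMDiff_codRestrict hmem Γ.contMDiff_push
  have hinv : ContMDiff (𝓡∂ 4) (𝓡∂ 4) ∞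
      (fun w : ↥(S.φ ⁻¹' Iic (sSup (range S.φ) - Γ.pushDepth)) => Γ.pull (w : W)) :=
    Γ.contMDiffOn_pull.comp_contMDiff (A.contMDiff_subtype_val (by norm_num)) hmem'
  refine ⟨{ toFun := (S.φ ⁻¹' Iic (sSup (range S.φ) - Γ.pushDepth)).codRestrict Γ.push hmem
            invFun := fun w => Γ.pull (w : W)
            left_inv := fun z => Γ.pull_push z
            right_inv := fun w => Subtype.ext (Γ.push_pull (hmem' w))
            contMDiff_toFun := hto
            contMDiff_invFun := hinv }, fun z => rfl, fun z hz => ?_⟩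
  exact Γ.push_eq_Fl_of_mem_boundary hz

omit hD in
omit [T2Space W] in
/-- **Covers of small depth**: for every `ε > 0` a flow-out input on the compact `W` has a cover
whose push depth is `≤ ε` (shrink the height of any cover: `κ = c₀ a / 2 ≤ a / 2`). [folklore] -/
theorem exists_cover_pushDepth_le (D : FlowoutInput 3 W) {ε : ℝ} (hε : 0 < ε) :
    ∃ Γ : D.Cover, Γ.pushDepth ≤ ε := by
  obtain ⟨Γ₀⟩ := D.nonempty_cover
  refine ⟨Γ₀.shrink ε hε, ?_⟩
  have h1 := (Γ₀.shrink ε hε).pushDepth_le_pushLen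
  have h2 := (Γ₀.shrink ε hε).two_mul_pushLen
  have h3 := Γ₀.shrink_a_le ε hε
  have h4 := (Γ₀.shrink ε hε).pushLen_pos
  linarith

end SteinStructure

end Literature.Geometry.Symplectic

end
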